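import Summits.CriticalPhenomena.PercolationContinuityZ3.Theorems.Transplant.FKConnectivityAllQK5
import Summits.CriticalPhenomena.PercolationContinuityZ3.Theorems.Transplant.FKConnectivityAllQDegThree
import HarnessLib

/-!
# Connectivity correlation inequalities for `φ_{w,q}`, every `q > 0` — the `K₅` certificate AT THE LEVEL OF SUPPORTS, and six vertices
# at hubs of degree at most three (`K₃,₃`, the triangular prism)

Helper file (`--supports stmt-CriticalPhenomena-4575`), FK sub-lane `prim-bschramm-fk-3` (gen 10) of the post-continuity programme;
builds on p205010 (kernel theorem, internal audit signed; external expert review pending).  No definitions, no named facts, no sorries;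
standard axioms.

`…K5` proves the hub covariance bound / adjacent-edge negative correlation on every vertex TYPE with at most five elements.  Here the
same is moved to every weight vector on ANY finite vertex type whose support spans at most five vertices (transport along the subtype
embedding, gen 8's `hubCovBoundUnder_image_iff`), in the support language of fk-1's class theorems (`NegCorrPairSupp`, `…DegThree`):
* `hubCovBoundUnder_of_supp_card_le_five`, **`negCorrPairSupp_of_verts_card_le_five`** — if every pair of `S` has both ends in a set `A`
  of at most five vertices containing `x, y, z`, then `(xy, xz)` is negatively correlated under every `φ_{w,q}` supported in `S`,
  `0 < q ≤ 1`;
* with fk-1 g7's degree-three elimination (`negCorrPairSupp_of_degree_three`, built on fk-3 g7's pendant-hub reduction):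
  `negCorrPairSupp_of_degree_three_verts_le_five` and **`negCorr_adj_of_card_le_six_of_degree_le_three`** — on every weighted graph
  with at most SIX vertices, any two edges `xy, xz` at a vertex `x` whose live pairs are among `xy, xz, xu` are negatively correlated
  under `φ_{w,q}` for every `q ∈ (0,1]`.  In particular every adjacent pair of `K₃,₃` and of the triangular prism (cubic graphs on six
  vertices: 3-connected, not series–parallel, not wheels — outside everything previously in the tree; certified numerically by fk-3 g6/g9).
[cite: Grimmett2006, §3.9 eq. (3.94), Conj. (3.96) (pp. 63–66); §4.3] [cite: Wagner2006, Conj. 5.3, Ex. 5.1–5.2, §5.3 (p. 13)]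
-/

noncomputable section

namespace Summit.CriticalPhenomena.PercolationContinuityZ3.Theorems

namespace FK

open MeasureTheory Literature.Probability.LatticeModels Literature.Probability.Percolation
open scoped Classical

variable {V : Type*} [Fintype V]

/-! ### Supports spanning at most five vertices -/

omit [Fintype V] in
/-- A pair with both ends in `A` is the image of a pair of the subtype `↥A`. [folklore] -/
theorem mem_range_sym2Map_subtype (A : Finset V) (e : Sym2 V) (he : ∀ v ∈ e, v ∈ A) :
    e ∈ Set.range (Sym2.map (Function.Embedding.subtype (· ∈ A))) := by
  induction e using Sym2.ind with
  | h a b => exact ⟨s(⟨a, he a (Sym2.mem_mk_left a b)⟩, ⟨b, he b (Sym2.mem_mk_right a b)⟩), by simp⟩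

/-- **The hub covariance bound for a weight vector whose support spans at most five vertices** (`0 < q ≤ 1`): if every pair of
nonzero parameter has both ends in `A`, `card A ≤ 5`, and `x, y, z ∈ A`, then `HubCovBoundUnder (φ_{w,q}) q x y z` — on ANY finite
vertex type. [cite: Grimmett2006, §3.9 eq. (3.94) (pp. 63–66); §4.3] [cite: Wagner2006, Conj. 5.3, Ex. 5.1–5.2 (p. 13)] -/
theorem hubCovBoundUnder_of_supp_card_le_five {q : ℝ} (hq0 : 0 < q) (hq1 : q ≤ 1) (w : Sym2 V → unitInterval) (A : Finset V)
    (hA : A.card ≤ 5) (hw : ∀ e, ((w e : unitInterval) : ℝ) ≠ 0 → ∀ v ∈ e, v ∈ A) {x y z : V} (hx : x ∈ A) (hy : y ∈ A)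
    (hz : z ∈ A) : HubCovBoundUnder (rcMeasureW w q ∅) q x y z := by
  set j : {v // v ∈ A} ↪ V := Function.Embedding.subtype (· ∈ A) with hj
  have hw' : ∀ e, e ∉ Set.range (Sym2.map j) → w e = 0 := by
    intro e he
    by_contra hne
    exact he (mem_range_sym2Map_subtype A e (hw e fun h0 => hne (Set.Icc.coe_eq_zero.1 h0)))
  have hcard : Fintype.card {v // v ∈ A} ≤ 5 := by rw [Fintype.card_coe]; exact hA
  exact (hubCovBoundUnder_image_iff j w hw' hq0 ⟨x, hx⟩ ⟨y, hy⟩ ⟨z, hz⟩).2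
    (hubCovBoundUnder_of_card_le_five hcard hq0 hq1 _ _ _ _)

/-- **Negative correlation of `(xy, xz)` under every `φ_{w,q}` supported in a pair set spanning at most five vertices** (`0 < q ≤ 1`,
`y ≠ z`, `x, y, z` among those vertices): the `K₅` certificate as a support-level block for fk-1's class theorems.
[cite: Grimmett2006, §3.9 eq. (3.94) (pp. 63–66)] [cite: Wagner2006, Conj. 5.3, Ex. 5.1–5.2 (p. 13)] -/
theorem negCorrPairSupp_of_verts_card_le_five {q : ℝ} (hq0 : 0 < q) (hq1 : q ≤ 1) {S : Set (Sym2 V)} (A : Finset V)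
    (hA : A.card ≤ 5) (hS : ∀ e ∈ S, ∀ v ∈ e, v ∈ A) {x y z : V} (hx : x ∈ A) (hy : y ∈ A) (hz : z ∈ A) (hyz : y ≠ z) :
    NegCorrPairSupp S q s(x, y) s(x, z) := by
  intro w hw
  refine negCorr_adj_of_hubCovBoundUnder hq0 hq1 w x y z hyz
    (hubCovBoundUnder_of_supp_card_le_five hq0 hq1 _ A hA (fun e he v hv => ?_) hx hy hz)
  have hwe : ((w e : unitInterval) : ℝ) ≠ 0 := by
    intro h0
    apply he
    simp only [Function.update_apply]
    split_ifs <;> simp [h0]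
  exact hS e (hw e hwe) v hv

/-! ### Six vertices, hubs of degree at most three -/

/-- **Degree-three elimination onto five vertices**: if the pairs of `S` at `x` are among `xy, xz, xu` and every pair of `S` avoiding
`x` has both ends in a set `A` of at most five vertices containing `u, y, z`, then `(xy, xz)` is negatively correlated under every
`φ_{w,q}` supported in `S` (`0 < q ≤ 1`). (fk-1 g7's `negCorrPairSupp_of_degree_three` + `negCorrPairSupp_of_verts_card_le_five`.)
[cite: Grimmett2006, §3.9 eq. (3.94) (p. 63); Thm. (3.1)(a) (p. 37)] [cite: Wagner2006, Conj. 5.3 (p. 13)] -/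
theorem negCorrPairSupp_of_degree_three_verts_le_five {q : ℝ} (hq0 : 0 < q) (hq1 : q ≤ 1) {S : Set (Sym2 V)} {x u y z : V}
    (hxu : x ≠ u) (hxy : x ≠ y) (hxz : x ≠ z) (hyu : y ≠ u) (hzu : z ≠ u) (hyz : y ≠ z)
    (hSx : ∀ e ∈ S, x ∈ e → e = s(x, y) ∨ e = s(x, z) ∨ e = s(x, u))
    (A : Finset V) (hA : A.card ≤ 5) (hSA : ∀ e ∈ S, x ∉ e → ∀ v ∈ e, v ∈ A) (hu : u ∈ A) (hy : y ∈ A) (hz : z ∈ A) :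
    NegCorrPairSupp S q s(x, y) s(x, z) := by
  refine negCorrPairSupp_of_degree_three hq0 hq1 hxu hxy hxz hyu hzu hyz hSx
    (negCorrPairSupp_of_verts_card_le_five hq0 hq1 A hA (fun e he v hv => ?_) hu hy hz hyz)
  rcases he with ⟨heS, hxe⟩ | he
  · exact hSA e heS hxe v hv
  · rcases he with rfl | rfl
    · rcases Sym2.mem_iff.1 hv with rfl | rfl
      · exact hu
      · exact hy
    · rcases Sym2.mem_iff.1 hv with rfl | rfl
      · exact hu
      · exact hz

/-- **Adjacent edges at a vertex of degree at most three are negatively correlated on every weighted graph with at most six vertices,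
`0 < q ≤ 1`**: if `card V ≤ 6` and the live pairs of `w` at `x` are among `xy, xz, xu` (`x, u, y, z` distinct), then
`φ_{w,q}(J_xy ∩ J_xz) ≤ φ_{w,q}(J_xy)·φ_{w,q}(J_xz)`.  In particular every two adjacent edges of `K₃,₃` and of the triangular prism
(all vertices of degree three) — kernel instances of the conjecture node `EdgeNegCorrAdjFKLtOne` beyond five vertices, wheels and
series–parallel supports. [cite: Grimmett2006, §3.9 eq. (3.94), Conj. (3.96) (pp. 63–66)] [cite: Wagner2006, Conj. 5.3, Ex. 5.1–5.2, §5.3 (p. 13)] -/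
theorem negCorr_adj_of_card_le_six_of_degree_le_three (hV : Fintype.card V ≤ 6) {q : ℝ} (hq0 : 0 < q) (hq1 : q ≤ 1)
    (w : Sym2 V → unitInterval) {x u y z : V} (hxu : x ≠ u) (hxy : x ≠ y) (hxz : x ≠ z) (hyu : y ≠ u) (hzu : z ≠ u)
    (hyz : y ≠ z) (hx : ∀ e, ((w e : unitInterval) : ℝ) ≠ 0 → x ∈ e → e = s(x, y) ∨ e = s(x, z) ∨ e = s(x, u)) :
    (rcMeasureW w q ∅).real ({ω | s(x, y) ∈ ω} ∩ {ω | s(x, z) ∈ ω}) ≤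
      (rcMeasureW w q ∅).real {ω | s(x, y) ∈ ω} * (rcMeasureW w q ∅).real {ω | s(x, z) ∈ ω} := by
  have hA : (Finset.univ.erase x).card ≤ 5 := by
    rw [Finset.card_erase_of_mem (Finset.mem_univ x), Finset.card_univ]
    omega
  have hmem : ∀ v, v ≠ x → v ∈ Finset.univ.erase x := fun v hv => Finset.mem_erase.2 ⟨hv, Finset.mem_univ v⟩
  refine negCorrPairSupp_of_degree_three_verts_le_five hq0 hq1 (S := {e | ((w e : unitInterval) : ℝ) ≠ 0}) hxu hxy hxz hyu hzu hyz
    (fun e he hxe => hx e he hxe) (Finset.univ.erase x) hA (fun e _ hxe v hv => hmem v fun hvx => hxe (hvx ▸ hv))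
    (hmem u hxu.symm) (hmem y hxy.symm) (hmem z hxz.symm) w fun g hg => hg

end FK

end Summit.CriticalPhenomena.PercolationContinuityZ3.Theorems

end
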